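import Summits.BirchSwinnertonDyer.BirchSwinnertonDyer.Theorems.ByReductionTypeAtTwoSupersingularFlatLocalLiftTwo
import Summits.BirchSwinnertonDyer.BirchSwinnertonDyer.Theorems.ByReductionTypeAtTwoSupersingularFlatCountTwoOfLocalOfPrint
import Summits.BirchSwinnertonDyer.BirchSwinnertonDyer.Theorems.ByReductionTypeAtTwoSupersingularTowerTorsionTwo
import Literature.NumberTheory.EllipticCurves.HeegnerPointsKolyvaginCebotarevProofs
import HarnessLib

/-!
# `hloc2` DISCHARGED: the ♭-local lift at the place above `2` in the EXACT shape displayed by the COUNT♭@2 door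
# (part 20) — and door v6: COUNT♭@2 from PRINT BY NAME with NO displayed input

Seat `bsd-2adic-ss-1` GEN 13, crux `SupersingularRankZeroAtTwo` (stmt-BirchSwinnertonDyer-19097, route
`ByReductionTypeAtTwo`, rung K4), line `flat_uniform_two` v1, stub (2) `stub_allFlatData`, conjunct COUNT♭@2.
`hloc2_of_flatData` = the hypothesis `hloc2` of `SSFlatEC.flatCountTwo_of_print_of_loc2` (door v5, part 15),
VERBATIM, from the line's own Honda₂ clauses: the place `w ∋ 2` is `v` (`ℚ` has one prime above `2`), Lemma 2.3
at `2` is the tree theorem `eq_zero_of_mem_localTowerPointsOfEmb_of_two_nsmul`, the ♭ lift is part 19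
(`exists_localLift_flat`), and the classical clause follows from the ♭ one (`E♭ ≤ Kummer ≤ 𝒦_w`).
`flatCountTwo_of_print_all` (door v6): **the COUNT♭@2 clause of `stub_allFlatData` from PRINT BY NAME
{Greenberg LNM 1716 Prop. 4.13 (Cassels), Prop. 4.12, pp. 119–120, p. 108 (`v ∤ p`), §5 p. 140 / Kato Thm. 12.4}
and the Honda₂ clauses ALONE** — no displayed input remains (RC-176 PATH endpoint: COUNT♭@2 =
PUB-COMPOSITE-by-name ∘ THEOREM). HONEST FRAMING: nothing about any curve is asserted; the crux's ∀-form stays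
MATH-BOUND (F4@(2), μ♭ = 0, Miller); no census cell moves; BSD is not proved by any of this.

References: [GreenbergLNM1716] §4 pp. 104–122, §5 p. 140; [Kato2004Asterisque] Thm. 12.4; [Sprung2012] §7.
-/

set_option autoImplicit false
-- the Theorems namespace of this sub repeats the summit name by design (D-0017 nested layout)
set_option linter.dupNamespace false

noncomputable section

open scoped Classical NumberField

open NumberField IsDedekindDomain WeierstrassCurve Literature.NumberTheory.EllipticCurves
  Literature.NumberTheory.GaloisRepresentations Literature.NumberTheory.EllipticCurves.ZpExtension
  Literature.NumberTheory.EllipticCurves.Kobayashi2003 Literature.NumberTheory.EllipticCurves.Sprung2017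
  Literature.NumberTheory.EllipticCurves.Sprung2012 Literature.NumberTheory.EllipticCurves.Sprung2024
  Literature.NumberTheory.EllipticCurves.IwasawaDual Literature.NumberTheory.EllipticCurves.IwasawaAlgebra
  Literature.NumberTheory.EllipticCurves.GreenbergVatsal2000 Literature.NumberTheory.EllipticCurves.Rank1Residual
  Summit.BirchSwinnertonDyer.Rank1Residual.X5.O1

namespace Summit.BirchSwinnertonDyer.BirchSwinnertonDyer.Theorems.SSFlatEC

/-- **`hloc2` of the COUNT♭@2 door, discharged.** For the ♭ Coleman data `(g, c)` at `v ∋ 2` with the Honda₂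
clauses (levels, `n ≥ 1` trace, level-`0` injectivity) on a good-supersingular `W/ℚ`: the ♭-local lift at every
`w ∋ 2`, in the exact shape displayed by `flatCountTwo_of_print_of_loc2`.
[cite: GreenbergLNM1716, §4 proof of Lemma 4.7 (p. 108)] [cite: Sprung2012, Def. 7.9, Lemma 7.10 (p. 1503)] -/
theorem hloc2_of_flatData (W : WeierstrassCurve ℚ) [W.IsElliptic] [W.IsGloballyMinimal] (hss : GoodSS W 2)
    (κ : ZpExtension ℚ 2) {v : HeightOneSpectrum (𝓞 ℚ)} (hv : (2 : 𝓞 ℚ) ∈ v.asIdeal)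
    {g : Field.absoluteGaloisGroup (v.adicCompletion ℚ)} {c : ℕ → localPoints W (v.adicCompletion ℚ)}
    (hg : κ.IsTopGenerator (resGalOfEmb (closureEmb (K := ℚ) (v.adicCompletion ℚ)) g))
    (hc : ∀ n, c n ∈ localLayerPointsOfEmb κ (closureEmb (K := ℚ) (v.adicCompletion ℚ)) W n)
    (hTr : ∀ n, 1 ≤ n → localTraceOfEmb κ (closureEmb (K := ℚ) (v.adicCompletion ℚ)) W n (n + 1)
      (c (n + 1)) = W.frobeniusTrace 2 • c n - c (n - 1))
    (hinj : ∀ z₀ : localLayerPointsOfEmb κ (closureEmb (K := ℚ) (v.adicCompletion ℚ)) W 0 →+ ℤ_[2],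
      evalOn W (localLayerPointsOfEmb κ (closureEmb (K := ℚ) (v.adicCompletion ℚ)) W 0) z₀ (c 0) = 0 →
        z₀ = 0)
    (S₀ : Finset (HeightOneSpectrum (𝓞 ℚ))) :
    ∀ t ∈ unramifiedOutside κ.kerSubgroup (W.geomPrimaryTorsion 2) 2
        (↑S₀ : Set (HeightOneSpectrum (𝓞 ℚ))),
      (∀ σ : Field.absoluteGaloisGroup ℚ, W.conjH1 2 κ.kerSubgroup σ t - t ∈
        sharpFlatSelmerInfty W κ (closureEmb (K := ℚ) (v.adicCompletion ℚ)) (W.frobeniusTrace 2) g c .flat) →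
      ∀ w : HeightOneSpectrum (𝓞 ℚ), ((2 : ℕ) : 𝓞 ℚ) ∈ w.asIdeal →
      ∃ xw : discreteH1 (localSubgroup (⊤ : Subgroup (Field.absoluteGaloisGroup ℚ)) (w.adicCompletion ℚ))
          (localPoints W (w.adicCompletion ℚ)),
        (∃ k : ℕ, 2 ^ k • xw = 0) ∧
        ∀ y : W.subgroupH1 2 (⊤ : Subgroup (Field.absoluteGaloisGroup ℚ)),
          W.localResOver 2 ⊤ (w.adicCompletion ℚ) y = xw →
          t - W.resOfLe 2 (le_top : κ.kerSubgroup ≤ ⊤) y ∈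
              W.localKerOver 2 κ.kerSubgroup (w.adicCompletion ℚ) ∧
          (w = v → t - W.resOfLe 2 (le_top : κ.kerSubgroup ≤ ⊤) y ∈
            sharpFlatLocalKummerOverOfEmb W 2 κ.kerSubgroup (closureEmb (K := ℚ) (v.adicCompletion ℚ))
              (localTowerPointsOfEmb κ (closureEmb (K := ℚ) (v.adicCompletion ℚ)) W)
              (colemanKer κ (closureEmb (K := ℚ) (v.adicCompletion ℚ)) W (W.frobeniusTrace 2) g c .flat)) := by
  intro t _ hconj w hw
  have hwv : w = v :=
    HeightOneSpectrum.eq_of_natCast_mem_rat Nat.prime_two hw (by exact_mod_cast hv)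
  subst hwv
  -- Lemma 2.3 at `2` (tree theorem, GEN 10)
  have hnt : ∀ P ∈ localTowerPointsOfEmb κ (closureEmb (K := ℚ) (w.adicCompletion ℚ)) W, 2 • P = 0 → P = 0 :=
    fun P hP h2 ↦ eq_zero_of_mem_localTowerPointsOfEmb_of_two_nsmul W hss κ hv _ hP h2
  -- the ♭-condition on `conj_g t − t` (the `σ' = 1` component of `Sel♭_∞`)
  have hone : W.conjH1 2 κ.kerSubgroup 1 = AddMonoidHom.id _ :=
    W.conjH1_of_mem_holds 2 κ.kerSubgroup (one_mem _)
  have ht : W.conjH1 2 κ.kerSubgroup (resGalOfEmb (closureEmb (K := ℚ) (w.adicCompletion ℚ)) g) t - t ∈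
      sharpFlatLocalKummerOverOfEmb W 2 κ.kerSubgroup (closureEmb (K := ℚ) (w.adicCompletion ℚ))
        (localTowerPointsOfEmb κ (closureEmb (K := ℚ) (w.adicCompletion ℚ)) W)
        (colemanKer κ (closureEmb (K := ℚ) (w.adicCompletion ℚ)) W (W.frobeniusTrace 2) g c .flat) := by
    have h := ((mem_sharpFlatSelmerInfty_iff W κ _ _ g c .flat _).1
      (hconj (resGalOfEmb (closureEmb (K := ℚ) (w.adicCompletion ℚ)) g))).2 1
    rwa [hone, AddMonoidHom.id_apply] at h
  -- part 19 (the instance `CharZero ℚ_w` is passed as a term: as a local instance it would let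
  -- `DivisionRing.toRatAlgebra` compete with the `adicCompletion` algebra structure)
  obtain ⟨xw, hxw, hmain⟩ := @exists_localLift_flat ℚ _ _ W _ 2 _ κ (w.adicCompletion ℚ) _
    (charZero_adicCompletion w) _ (W.frobeniusTrace 2) hss.2 g hg c hc hTr hinj hnt t ht
  refine ⟨xw, hxw, fun y hy ↦ ⟨?_, fun _ ↦ hmain y hy⟩⟩
  exact localKummerOverOfEmb_le_localKerOverOfEmb _
    (sharpFlatLocalKummerOverOfEmb_le_localKummerOverOfEmb _ _ (hmain y hy))

/-- **DOOR v6 — COUNT♭@2 from PRINT BY NAME and the Honda₂ clauses alone; no displayed input.** Door v5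
(`flatCountTwo_of_print_of_loc2`) with `hloc2` discharged by `hloc2_of_flatData`. Displayed residue: none. The
named facts: Greenberg LNM 1716 Prop. 4.13 (Cassels), Prop. 4.12, pp. 119–120, p. 108, §5 p. 140 (Kato Thm. 12.4).
[cite: GreenbergLNM1716, §4 Prop. 4.12, Prop. 4.13 / p. 122, pp. 108, 119–120; §5 p. 140]
[cite: Kato2004Asterisque, Thm. 12.4 (1)(2) p. 221] [cite: Sprung2012, §7 Def. 7.9–7.11 (p. 1503)] -/
theorem flatCountTwo_of_print_all (W : WeierstrassCurve ℚ) [W.IsElliptic] [W.IsGloballyMinimal]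
    (hss : GoodSS W 2) (κ : ZpExtension ℚ 2) (hκ : κ.IsCyclotomic) {γ : Field.absoluteGaloisGroup ℚ}
    (hγ : κ.IsTopGenerator γ) {v : HeightOneSpectrum (𝓞 ℚ)} (hv : (2 : 𝓞 ℚ) ∈ v.asIdeal)
    {g : Field.absoluteGaloisGroup (v.adicCompletion ℚ)} {c : ℕ → localPoints W (v.adicCompletion ℚ)}
    (hg : κ.IsTopGenerator (resGalOfEmb (closureEmb (K := ℚ) (v.adicCompletion ℚ)) g))
    (hc : ∀ n, c n ∈ localLayerPointsOfEmb κ (closureEmb (K := ℚ) (v.adicCompletion ℚ)) W n)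
    (hTr : ∀ n, 1 ≤ n → localTraceOfEmb κ (closureEmb (K := ℚ) (v.adicCompletion ℚ)) W n (n + 1)
      (c (n + 1)) = W.frobeniusTrace 2 • c n - c (n - 1))
    (hinj : ∀ z₀ : localLayerPointsOfEmb κ (closureEmb (K := ℚ) (v.adicCompletion ℚ)) W 0 →+ ℤ_[2],
      evalOn W (localLayerPointsOfEmb κ (closureEmb (K := ℚ) (v.adicCompletion ℚ)) W 0) z₀ (c 0) = 0 →
        z₀ = 0)
    (hsat : ∀ a : ℤ_[2],
      (∃ z₀ : localLayerPointsOfEmb κ (closureEmb (K := ℚ) (v.adicCompletion ℚ)) W 0 →+ ℤ_[2],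
        evalOn W (localLayerPointsOfEmb κ (closureEmb (K := ℚ) (v.adicCompletion ℚ)) W 0) z₀ (c 0) =
          2 * a) →
      ∃ y : localLayerPointsOfEmb κ (closureEmb (K := ℚ) (v.adicCompletion ℚ)) W 0 →+ ℤ_[2],
        evalOn W (localLayerPointsOfEmb κ (closureEmb (K := ℚ) (v.adicCompletion ℚ)) W 0) y (c 0) = a)
    (S₀ : Finset (HeightOneSpectrum (𝓞 ℚ)))
    (hgood : ∀ w : HeightOneSpectrum (𝓞 ℚ), w ∉ S₀ → ((2 : ℕ) : 𝓞 ℚ) ∉ w.asIdeal → W.HasGoodReductionAt w)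
    -- PRINT BY NAME
    (hC : Greenberg1999.casselsSurjectivity_H1Sigma ℚ)
    (h412 : Greenberg1999.prop412_noFiniteSubmodule_H1Sigma_of_rank_one)
    (hcork : Greenberg1999.h1Sigma_zpCorank_le_degree ℚ)
    (hP108 : Greenberg1999.localQuotient_restriction_surjective ℚ)
    (hWL : Greenberg1999.h1SigmaInfty_rank_eq_one) :
    Finite (W.selmerGroupPInfty 2) →
      Finite (EndCoinvariants (conjSharpFlatSelmerInfty W κ (closureEmb (K := ℚ) (v.adicCompletion ℚ))
        (W.frobeniusTrace 2) g c .flat γ - 1)) →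
      Nat.card (↥((sharpFlatSelmerInfty W κ (closureEmb (K := ℚ) (v.adicCompletion ℚ))
            (W.frobeniusTrace 2) g c .flat).comap (W.layerToInfty κ 0)) ⧸
          (W.selmerLayer κ 0).addSubgroupOf
            ((sharpFlatSelmerInfty W κ (closureEmb (K := ℚ) (v.adicCompletion ℚ))
              (W.frobeniusTrace 2) g c .flat).comap (W.layerToInfty κ 0))) *
        Nat.card (MulAction.fixedPoints (Field.absoluteGaloisGroup ℚ) (W.geomPrimaryTorsion 2)) =
      2 ^ (padicValNat 2 W.tamagawaProduct) *
        Nat.card (EndCoinvariants (conjSharpFlatSelmerInfty W κ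
          (closureEmb (K := ℚ) (v.adicCompletion ℚ)) (W.frobeniusTrace 2) g c .flat γ - 1)) :=
  flatCountTwo_of_print_of_loc2 W hss κ hκ hγ hv hg hc hTr hinj hsat S₀ hgood hC h412 hcork hP108 hWL
    (hloc2_of_flatData W hss κ hv hg hc hTr hinj S₀)

end Summit.BirchSwinnertonDyer.BirchSwinnertonDyer.Theorems.SSFlatEC

end
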